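import Mathlib
import Summits.ValiantsHypothesis.ValiantsHypothesis.Theorems.GeneratorObstructionsPowGenDegreeQPGadgetTableauWords

/-!
# Route GeneratorObstructions — crux K2 `PowGenDegreeQP` (stmt-ValiantsHypothesis-11655), line
# `trace-side-regimes`: contents of a label under a fibrewise rearrangement, kind by kind

Step (R2, third part) of the last certificate theorem (`gadgetTab_fiberSum_eq_pow`).  With
`word_triple` / `word_pair` (…GadgetTableauWords) every box of the label `labelOf j q ℓ` receives a
block-`j` letter `x (letterRow c j κ')`; here the received KIND is packaged as `recvKind` and the
content is evaluated letter by letter: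

* `recvKind ρ j q ℓ s` — the kind received by the `s`-th box (via the transported permutations
  `tripleσ ρ j q i := (fibreEquivTriple …).permCongr (ρ (3kq+i) j)` and
  `pairτ ρ j q i := (fibreEquivPair …).permCongr (ρ (3k·2^j+3kq+i) j)`);
* `word_eq_recvKind` — `word π (labelOf j q ℓ) s = x (letterRow c j (recvKind … s))`;
* `content_labelOf_apply_letterRow` — `content π (labelOf j q ℓ) (x (letterRow c j κ₀)) =
  #{s | recvKind … s = κ₀}`, and `content_labelOf_apply_eq_zero` off the block-`j` letters;
* `gadgetExp_apply_letterRow` — the target values `k, 2k, 2k` (and `0` on other blocks);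
* `valid_labelOf_iff` — **validity of the label `labelOf j q ℓ` ⟺ for every kind `κ₀`,
  `#{s | recvKind … s = κ₀} = (if κ₀ = 2 then k else 2k)`**.

What remains after this file: identify these counts with `blockExpo k (tripleσ ρ j q) (pairτ ρ j q)`
(…BlockCountGen) and regroup over (block, copy) with `sum_pi_prod_fiberwise` (…PiFiberwise).

Honest framing: combinatorics of one explicit tableau; no stub, crux or summit is settled here;
`VP ≠ VNP` untouched. [folklore]
-/

namespace Summit.ValiantsHypothesis.ValiantsHypothesis.Theorems.GeneratorObstructions.PowGenDegreeQP

open Literature.Computability.AlgebraicComplexity Literature.Computability.AlgebraicComplexity.TableauEval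

-- `Summit.ValiantsHypothesis.ValiantsHypothesis.…` is the tree's mandated single-conjunct layout.
set_option linter.dupNamespace false

noncomputable section

variable {σ : Type*}

/-! ## §1 Column indices of a copy -/

/-- The triple column `3kq + i` of copy `(j,q)` is a column, of type `< j`. [folklore] -/
theorem tripleCol_lt {k c j q i : ℕ} (hj : j < c) (hq : q < 2 ^ j) (hi : i < 3 * k) :
    3 * k * q + i < 3 * k * 2 ^ c ∧ 3 * k * q + i < 3 * k * 2 ^ j := by
  have h1 : 2 ^ j ≤ 2 ^ c := Nat.pow_le_pow_right (by norm_num) hj.le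
  constructor <;> nlinarith

/-- The pair column `3k·2^j + 3kq + i` of copy `(j,q)` is a column of type `j`. [folklore] -/
theorem pairCol_lt {k c j q i : ℕ} (hj : j < c) (hq : q < 2 ^ j) (hi : i < 3 * k) :
    3 * k * 2 ^ j + 3 * k * q + i < 3 * k * 2 ^ c ∧
      3 * k * 2 ^ j ≤ 3 * k * 2 ^ j + 3 * k * q + i ∧
      3 * k * 2 ^ j + 3 * k * q + i < 3 * k * 2 ^ (j + 1) := by
  have h1 : 2 ^ (j + 1) ≤ 2 ^ c := Nat.pow_le_pow_right (by norm_num) hj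
  rw [pow_succ] at h1 ⊢
  refine ⟨by nlinarith, by omega, by nlinarith⟩

/-- The transported triple permutations of copy `(j,q)`: `σ_i ∈ Perm (Fin 3)`. [folklore] -/
def tripleσ (k c : ℕ) (hk : 1 ≤ k) (hc : 1 ≤ c) (x : ℕ → σ)
    (ρ : (n : Fin (gadgetTab k c hk hc x).C) → (j : Fin c) →
      Equiv.Perm {r : Fin ((gadgetTab k c hk hc x).h n) // rowBlock k c hk hc x n r = j})
    (j : Fin c) (q : ℕ) (hq : q < 2 ^ j.val) (i : Fin (3 * k)) : Equiv.Perm (Fin 3) :=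
  (fibreEquivTriple k c hk hc x ⟨3 * k * q + i, (tripleCol_lt j.isLt hq i.isLt).1⟩ j
      (tripleCol_lt j.isLt hq i.isLt).2).permCongr
    (ρ ⟨3 * k * q + i, (tripleCol_lt j.isLt hq i.isLt).1⟩ j)

/-- The transported pair permutations of copy `(j,q)`: `τ_i ∈ Perm (Fin 2)`. [folklore] -/
def pairτ (k c : ℕ) (hk : 1 ≤ k) (hc : 1 ≤ c) (x : ℕ → σ)
    (ρ : (n : Fin (gadgetTab k c hk hc x).C) → (j : Fin c) →
      Equiv.Perm {r : Fin ((gadgetTab k c hk hc x).h n) // rowBlock k c hk hc x n r = j})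
    (j : Fin c) (q : ℕ) (hq : q < 2 ^ j.val) (i : Fin (3 * k)) : Equiv.Perm (Fin 2) :=
  (fibreEquivPair k c hk hc x ⟨3 * k * 2 ^ j.val + 3 * k * q + i, (pairCol_lt j.isLt hq i.isLt).1⟩ j
      (pairCol_lt j.isLt hq i.isLt).2.1 (pairCol_lt j.isLt hq i.isLt).2.2).permCongr
    (ρ ⟨3 * k * 2 ^ j.val + 3 * k * q + i, (pairCol_lt j.isLt hq i.isLt).1⟩ j)

/-- The kind of D*-label `ℓ` in pair column `i`, as an element of `Fin 2`. [folklore] -/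
def pairKind2 (k : ℕ) (ℓ : Fin 3) (i : ℕ) : Fin 2 :=
  ⟨(pairKind k ℓ i).val, by
    have := pairKind_ne_two k ℓ i
    have h3 := (pairKind k ℓ i).isLt
    have : (pairKind k ℓ i).val ≠ 2 := fun h => this (Fin.ext h)
    omega⟩

/-- The kind received by the `s`-th box of `labelOf j q ℓ`. [folklore] -/
def recvKind (k c : ℕ) (hk : 1 ≤ k) (hc : 1 ≤ c) (x : ℕ → σ)
    (ρ : (n : Fin (gadgetTab k c hk hc x).C) → (j : Fin c) →
      Equiv.Perm {r : Fin ((gadgetTab k c hk hc x).h n) // rowBlock k c hk hc x n r = j})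
    (j : Fin c) (q : ℕ) (hq : q < 2 ^ j.val) (ℓ : Fin 3) (s : Fin (5 * k)) : Fin 3 :=
  if hs : s.val < 3 * k then
    tripleσ k c hk hc x ρ j q hq ⟨s.val, hs⟩ ((tripleLabNat k s.val)⁻¹ ℓ)
  else
    Fin.castSucc (pairτ k c hk hc x ρ j q hq ⟨pairIdx k ℓ (s.val - 3 * k),
        pairIdx_lt (by have := s.isLt; omega) ℓ⟩
      (pairKind2 k ℓ (pairIdx k ℓ (s.val - 3 * k))))

/-- **Every box of `labelOf j q ℓ` receives the block-`j` letter of kind `recvKind`.** [folklore] -/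
theorem word_eq_recvKind (k c : ℕ) (hk : 1 ≤ k) (hc : 1 ≤ c) (x : ℕ → σ)
    (ρ : (n : Fin (gadgetTab k c hk hc x).C) → (j : Fin c) →
      Equiv.Perm {r : Fin ((gadgetTab k c hk hc x).h n) // rowBlock k c hk hc x n r = j})
    (j : Fin c) (q : ℕ) (hq : q < 2 ^ j.val) (ℓ : Fin 3) (s : Fin (5 * k)) :
    (gadgetTab k c hk hc x).word (fiberPermPi (rowBlock k c hk hc x) ρ)
        ⟨labelOf j q ℓ, labelOf_lt j.isLt hq ℓ⟩ s =
      x (letterRow c j (recvKind k c hk hc x ρ j q hq ℓ s)) := by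
  unfold recvKind
  split_ifs with hs
  · have h := word_triple k c hk hc x ρ j hq ℓ hs (tripleCol_lt j.isLt hq hs).1
      (tripleCol_lt j.isLt hq hs).2
    have hs' : (⟨s.val, by change s.val < 5 * k; omega⟩ : Fin (gadgetTab k c hk hc x).m) = s :=
      Fin.ext rfl
    rw [hs'] at h
    rw [h]
    rfl
  · have ht : s.val - 3 * k < 2 * k := by have := s.isLt; omega
    have h := word_pair k c hk hc x ρ j hq ℓ ht (pairCol_lt j.isLt hq (pairIdx_lt ht ℓ)).1
      (pairCol_lt j.isLt hq (pairIdx_lt ht ℓ)).2.1 (pairCol_lt j.isLt hq (pairIdx_lt ht ℓ)).2.2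
    have hs' : (⟨3 * k + (s.val - 3 * k), by change _ < 5 * k; omega⟩ :
        Fin (gadgetTab k c hk hc x).m) = s := Fin.ext (by simp only; omega)
    rw [hs'] at h
    rw [h]
    rfl

/-- **Content of a label, letter by letter**: at the block-`j` letter of kind `κ₀` the content counts
the boxes receiving kind `κ₀`. [folklore] -/
theorem content_labelOf_apply_letterRow [LinearOrder σ] (k c : ℕ) (hk : 1 ≤ k) (hc : 1 ≤ c) (x : ℕ → σ)
    {N : ℕ} (hx : IsAntitoneEnum x N)
    (hN : 3 * c ≤ N)
    (ρ : (n : Fin (gadgetTab k c hk hc x).C) → (j : Fin c) →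
      Equiv.Perm {r : Fin ((gadgetTab k c hk hc x).h n) // rowBlock k c hk hc x n r = j})
    (j : Fin c) (q : ℕ) (hq : q < 2 ^ j.val) (ℓ : Fin 3) (κ₀ : Fin 3) :
    (gadgetTab k c hk hc x).content (fiberPermPi (rowBlock k c hk hc x) ρ)
        ⟨labelOf j q ℓ, labelOf_lt j.isLt hq ℓ⟩ (x (letterRow c j κ₀)) =
      (Finset.univ.filter fun s : Fin (5 * k) => recvKind k c hk hc x ρ j q hq ℓ s = κ₀).card := by
  classical
  rw [TabM.content, wordContent_apply]
  change (Finset.univ.filter fun s : Fin (5 * k) => _).card = _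
  congr 1
  ext s
  simp only [Finset.mem_filter, Finset.mem_univ, true_and]
  rw [word_eq_recvKind]
  constructor
  · intro h; exact (letter_inj hx hN j.isLt j.isLt h).2
  · intro h; rw [h]

/-- Off the block-`j` letters the content of a block-`j` label vanishes. [folklore] -/
theorem content_labelOf_apply_eq_zero [LinearOrder σ] (k c : ℕ) (hk : 1 ≤ k) (hc : 1 ≤ c) (x : ℕ → σ)
    (ρ : (n : Fin (gadgetTab k c hk hc x).C) → (j : Fin c) →
      Equiv.Perm {r : Fin ((gadgetTab k c hk hc x).h n) // rowBlock k c hk hc x n r = j})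
    (j : Fin c) (q : ℕ) (hq : q < 2 ^ j.val) (ℓ : Fin 3) {v : σ}
    (hv : ∀ κ : Fin 3, v ≠ x (letterRow c j κ)) :
    (gadgetTab k c hk hc x).content (fiberPermPi (rowBlock k c hk hc x) ρ)
        ⟨labelOf j q ℓ, labelOf_lt j.isLt hq ℓ⟩ v = 0 := by
  classical
  rw [TabM.content, wordContent_apply, Finset.card_eq_zero, Finset.filter_eq_empty_iff]
  intro s _ h
  rw [word_eq_recvKind k c hk hc x ρ j q hq ℓ s] at h
  exact hv _ h.symm

/-- Values of a gadget monomial at the block letters: `2k, 2k, k` on its own block (kinds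
`A', A, B`), `0` on other blocks. [folklore] -/
theorem gadgetExp_apply_letterRow [LinearOrder σ] (k c : ℕ) (x : ℕ → σ) {N : ℕ} (hx : IsAntitoneEnum x N) (hN : 3 * c ≤ N)
    {j : ℕ} (hj : j < c) (j' : Fin c) (κ₀ : Fin 3) :
    gadgetExp k (fun i : Fin c => x (letterRow c i 2)) (fun i => x (letterRow c i 1))
        (fun i => x (letterRow c i 0)) j' (x (letterRow c j κ₀)) =
      if j'.val = j then (if κ₀ = 2 then k else 2 * k) else 0 := by
  classical
  simp only [gadgetExp, Finsupp.coe_add, Pi.add_apply, Finsupp.single_apply]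
  by_cases hjj : j'.val = j
  · rw [if_pos hjj]
    rcases fin3_cases κ₀ with rfl | rfl | rfl
    · rw [if_neg (fun h => absurd (letter_inj hx hN j'.isLt hj h).2 (by decide)),
        if_neg (fun h => absurd (letter_inj hx hN j'.isLt hj h).2 (by decide)),
        if_pos (by rw [hjj]), if_neg (by decide)]
      ring
    · rw [if_neg (fun h => absurd (letter_inj hx hN j'.isLt hj h).2 (by decide)),
        if_pos (by rw [hjj]),
        if_neg (fun h => absurd (letter_inj hx hN j'.isLt hj h).2 (by decide)), if_neg (by decide)]
      ring
    · rw [if_pos (by rw [hjj]),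
        if_neg (fun h => absurd (letter_inj hx hN j'.isLt hj h).2 (by decide)),
        if_neg (fun h => absurd (letter_inj hx hN j'.isLt hj h).2 (by decide)), if_pos rfl]
      ring
  · rw [if_neg hjj, if_neg (fun h => hjj (letter_inj hx hN j'.isLt hj h).1),
      if_neg (fun h => hjj (letter_inj hx hN j'.isLt hj h).1),
      if_neg (fun h => hjj (letter_inj hx hN j'.isLt hj h).1)]
    rfl

/-- **Validity of one label as a kind count**: the label `labelOf j q ℓ` receives the gadget monomial
of block `j` iff for every kind `κ₀` exactly `k` (for `B`) resp. `2k` (for `A'`, `A`) of its boxes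
receive kind `κ₀`. [folklore] -/
theorem valid_labelOf_iff [LinearOrder σ] (k c : ℕ) (hk : 1 ≤ k) (hc : 1 ≤ c) (x : ℕ → σ)
    {N : ℕ} (hx : IsAntitoneEnum x N) (hN : 3 * c ≤ N)
    (ρ : (n : Fin (gadgetTab k c hk hc x).C) → (j : Fin c) →
      Equiv.Perm {r : Fin ((gadgetTab k c hk hc x).h n) // rowBlock k c hk hc x n r = j})
    (j : Fin c) (q : ℕ) (hq : q < 2 ^ j.val) (ℓ : Fin 3) :
    (gadgetTab k c hk hc x).content (fiberPermPi (rowBlock k c hk hc x) ρ)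
        ⟨labelOf j q ℓ, labelOf_lt j.isLt hq ℓ⟩ =
      gadgetExp k (fun i : Fin c => x (letterRow c i 2)) (fun i => x (letterRow c i 1))
        (fun i => x (letterRow c i 0)) j ↔
      ∀ κ₀ : Fin 3, (Finset.univ.filter fun s : Fin (5 * k) =>
        recvKind k c hk hc x ρ j q hq ℓ s = κ₀).card = (if κ₀ = 2 then k else 2 * k) := by
  classical
  constructor
  · intro h κ₀
    have := congrArg (fun f => f (x (letterRow c j κ₀))) h
    rw [content_labelOf_apply_letterRow k c hk hc x hx hN, gadgetExp_apply_letterRow k c x hx hN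
      j.isLt, if_pos rfl] at this
    exact this
  · intro h
    ext v
    by_cases hv : ∃ κ : Fin 3, v = x (letterRow c j κ)
    · obtain ⟨κ₀, rfl⟩ := hv
      rw [content_labelOf_apply_letterRow k c hk hc x hx hN, gadgetExp_apply_letterRow k c x hx hN
        j.isLt, if_pos rfl]
      exact h κ₀
    · push Not at hv
      rw [content_labelOf_apply_eq_zero k c hk hc x ρ j q hq ℓ hv]
      symm
      by_contra hne
      obtain ⟨κ, hκ⟩ := exists_kind_of_gadgetExp_ne_zero k j hne
      exact hv κ hκ

end

end Summit.ValiantsHypothesis.ValiantsHypothesis.Theorems.GeneratorObstructions.PowGenDegreeQP
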